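import Summits.Ventures.YMGap.RobustBall.StarKernelClusteringZd
import Summits.Ventures.YMGap.RobustBall.StarBoundaryDecayZdGeometric
import Summits.Ventures.YMGap.RobustBall.MassGapOnBallZdGRows
import HarnessLib

/-!
# Venture YMGap, track ROBUST-BALL — C-KMIX-STAR UNIFORMLY ON THE GAUGE-INVARIANT TIER-1 `ℤ^d` BALL: finite-volume clustering and
# boundary decay with ANY boundary field through ds-2's ROBUST STAR DOOR, and the `SU(2)` rows up to `β_W = 1/3`

HONEST FRAMING. WHAT THIS IS: a venture file (cell `pub-ymgap`, track Y2 ROBUST-BALL, seat ds-3, theorems only) joining the seat's kernel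
star doors (`StarKernelClusteringZd.abs_covariance_kernel_le_of_starWindowBoundZdR`,
`StarBoundaryDecayZdGeometric.abs_kernel_sub_integral_le_of_starArray_geometric`; both at the GEOMETRIC rate `ρ^{depth/(D+2)}`)
with ds-2's robust star door on the gauge-invariant tier-1 ball (`starWindowBoundZdR_of_memBallZdG`, the hypotheses of
`massGapOnBallZdG_of_robustStar` verbatim; quasilocality `perturbed_star_hloc`, locality radius `D = max R 1 + 2`):
* ★★ `kernel_covariance_decay_of_robustStar` — for EVERY member `(W, supp)` of `MemBallZdG ε₀ ε₁ R`, every finite link volume `Λ₀`, EVERY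
  boundary field `η`, every depth function `φ` of `Λ₀` and Lipschitz cylinders `F₁` (links `Λ₁ ⊆ Λ₀`, `φ ≥ m` on `Λ₁`), `F₂`:
  `|cov_{γ^W_{Λ₀}(·|η)}(F₁, F₂)| ≤ 2(2√N)² #Λ₁ #Λ₂ K₁K₂ · ρ^{min(⌊dist(Λ₁,Λ₂)/(D+2)⌋, ⌊m/(D+2)⌋)}` (geometric rate);
* ★★ `boundary_decay_of_robustStar` — same door, every DLR state `μ` of the member, every Lipschitz cylinder `F` (links `Δ ⊆ Λ₀`, `φ ≥ m`):
  `|∫F dγ^W_{Λ₀}(·|η) − ∫F dμ| ≤ (2√N) K #Δ · ρ^{⌊m/(D+2)⌋}`;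
* `su2_kernel_covariance_decay_star_ball` — the `SU(2)`, `d = 4` schema on the quarter modulus (hypotheses
  of `su2_massGapOnBallZdG_star`), and ★★ the HYPOTHESIS-FREE row up to `β_W = 1/3` on `MemBallZdG (3/125) (3/250) R`
  (`su2_kernel_covariance_decay_star_ball_upTo_oneThird`, `su2_boundary_decay_star_ball_upTo_oneThird`; certificate of `MassGapOnBallZdGRows`).
WHAT THIS IS NOT: interior form (the decay saturates at the depth inside `Λ₀`); the radii and the rate `−log ρ` are door artefacts; strong-coupling
LATTICE statements; nothing about the continuum limit or the Clay Millennium problem.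

References: R. L. Dobrushin, S. B. Shlosman (1985) Thm. 1; H. Föllmer, LNM 1362 (1988) Ch. I (2.10), Thm. (2.13); ds-2's `RobustStarDoorZd.lean`,
`MassGapOnBallZdGRows.lean`, rb-p1's `StarDoorZdGeometric.lean` (Gibbs states, same rate); the seat's `StarKernelClusteringZd.lean`,
`StarBoundaryDecayZdGeometric.lean`.
-/

noncomputable section

open MeasureTheory ProbabilityTheory Function Finset Real
open scoped NNReal
open Literature.Probability.LatticeModels
open Literature.Probability.LatticeModels.DobrushinMetric (IsLipBound)
open Literature.MathematicalPhysics.QuantumLattice hiding torusNorm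
open Literature.MathematicalPhysics.QuantumFieldTheory (suFrobDist suFrobDist_nonneg suFrobDist_le
  suFrobDist_self suEntries dist_suEntries_le_suFrobDist IsLipschitzCylinder setDistEdges)
open Literature.MathematicalPhysics.QuantumFieldTheory.Balaban1983to89.StrongCouplingDobrushinWindow (OneLinkKRModulus)
open Summit.Ventures.YMGap.DSWindowZd
open Summit.Ventures.YMGap.StarResolventDim (Delta gaugeR doorPoly gaugeR_lt_one_of_door)

namespace Summit.Ventures.YMGap.RobustBall

variable {d N : ℕ}

/-! ### The gauge-invariant tier-1 ball through the robust star door -/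

/-- ★★ **FINITE-VOLUME CLUSTERING WITH ANY BOUNDARY FIELD, UNIFORMLY ON THE GAUGE-INVARIANT TIER-1 `ℤ^d` BALL, through the ROBUST STAR DOOR**
(hypotheses of ds-2's `massGapOnBallZdG_of_robustStar`: one-link modulus `K` at radius `Rm ≥ 2(d−1)|β|`, 't Hooft coupling `β`, per-incidence
coefficient `c`, cross row `lam`, in-star row `θ < 1`, `doorPoly d c < 1`, received sum `ρ < 1`). For EVERY member `(W, supp) ∈ MemBallZdG ε₀ ε₁ R`,
every finite link volume `Λ₀`, EVERY boundary field `η`, every depth function `φ` (`1`-Lipschitz, `φ > 0 ⇒ ∈ Λ₀`) and Lipschitz cylinders `F₁` (links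
`Λ₁ ⊆ Λ₀`, `φ ≥ m` on `Λ₁`), `F₂`: with `D = max R 1 + 2`,
`|cov_{γ^W_{Λ₀}(·|η)}(F₁, F₂)| ≤ 2(2√N)² #Λ₁ #Λ₂ K₁ K₂ · ρ^{min(⌊dist(Λ₁,Λ₂)/(D+2)⌋, ⌊m/(D+2)⌋)}`. [folklore] -/
theorem kernel_covariance_decay_of_robustStar (hd : 2 ≤ d) (hN : 1 ≤ N) {β ε₀ ε₁ Rm K c lam θ ρ : ℝ} {R Kn : ℕ}
    (hK : 0 ≤ K) (hRm : |(N : ℝ) * β| / N * (2 * ((d : ℝ) - 1)) ≤ Rm) (hmod : OneLinkKRModulus N Rm K)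
    (hε₁ : 0 ≤ ε₁) (hc : K * Real.exp ε₀ * (1 + 2 * Real.sqrt N * ε₁) * (|(N : ℝ) * β| / N) ≤ c)
    (hlam : Real.sqrt N * ε₁ ≤ lam) (hθ : θ = (2 * (d : ℝ) - 2) * c + lam) (hθ1 : θ < 1)
    (hcd : doorPoly d c < 1) (hρ : ρ = gaugeR d c + (lam + θ ^ Kn * (4 * d * lam)) / (1 - θ)) (hρ1 : ρ < 1)
    {W : Potential (ZdEdge d) (SUN N)} {supp : Finset (ZdEdge d) → Finset (Finset (ZdEdge d))}
    (hW : MemBallZdG ε₀ ε₁ R W supp)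
    (Λ₀ : Finset (ZdEdge d)) (η : LGConfig d (SUN N)) (φ : ZdEdge d → ℝ)
    (hφ : ∀ x y : ZdEdge d, φ x ≤ φ y + ‖x.1 - y.1‖) (hφΛ : ∀ x, 0 < φ x → x ∈ Λ₀)
    {F₁ F₂ : LGConfig d (SUN N) → ℝ} {Λ₁ Λ₂ : Finset (ZdEdge d)} {K₁ K₂ : ℝ≥0}
    (hF₁ : IsLipschitzCylinder (fundamentalRep (Fin N)) F₁ Λ₁ K₁)
    (hF₂ : IsLipschitzCylinder (fundamentalRep (Fin N)) F₂ Λ₂ K₂) (hΛ₁ : Λ₁ ⊆ Λ₀) {m : ℝ} (hm : ∀ x ∈ Λ₁, m ≤ φ x) :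
    |cov[F₁, F₂; perturbedYM (d := d) (fundamentalRep (Fin N)) ((N : ℝ) * β) W supp Λ₀ η]| ≤
      2 * (2 * Real.sqrt N) ^ 2 * Λ₁.card * Λ₂.card * ((K₁ : ℝ) * K₂) *
        ρ ^ (min (⌊setDistEdges Λ₁ Λ₂ / (max R 1 + 2 + 2 : ℕ)⌋₊) (⌊m / (max R 1 + 2 + 2 : ℕ)⌋₊)) := by
  classical
  haveI : SecondCountableTopology (Matrix (Fin N) (Fin N) ℂ) :=
    inferInstanceAs (SecondCountableTopology (Fin N → Fin N → ℂ))
  haveI : SecondCountableTopology (SUN N) := Topology.IsEmbedding.subtypeVal.secondCountableTopology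
  have hc0 : 0 ≤ c := le_trans (by positivity) hc
  have hlam0 : 0 ≤ lam := le_trans (by positivity) hlam
  have hgR : 0 ≤ gaugeR d c ∧ gaugeR d c < 1 := gaugeR_lt_one_of_door hd hc0 hcd
  have hd2 : (2 : ℝ) ≤ d := by exact_mod_cast hd
  have hθ0 : 0 ≤ θ := by rw [hθ]; nlinarith
  have h1θ : 0 < 1 - θ := by linarith
  have hρ0 : 0 ≤ ρ := by
    rw [hρ]
    refine add_nonneg hgR.1 (div_nonneg (add_nonneg hlam0 ?_) h1θ.le)
    have : 0 ≤ θ ^ Kn := pow_nonneg hθ0 Kn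
    positivity
  have hWb : ∀ X, ∃ C, ∀ U, |W X U| ≤ C := fun X => exists_bound_of_continuous (hW.continuous X)
  have hγ : IsSpecification (perturbedYM (d := d) (fundamentalRep (Fin N)) ((N : ℝ) * β) W supp) :=
    isSpecification_perturbedYM _ (continuous_fundamentalRep (Fin N)) _
      (fun X => ⟨hW.dependsOn X, (hW.continuous X).measurable⟩) hWb hW.supportedBy
  have hD : R + 2 ≤ max R 1 + 2 := by omega
  have hloc : ∀ (cc : ZdEdge d) (ζ ζ' : LGConfig d (SUN N)), (∀ v ∈ starNbhdZdR (max R 1 + 2) cc.1, ζ v = ζ' v) →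
      ∀ (f : LGConfig d (SUN N) → ℝ), Measurable f → (∃ B, ∀ σ, |f σ| ≤ B) →
        DependsOn f (starWinZd cc : Set (ZdEdge d)) →
        ∫ σ, f σ ∂(perturbedYM (d := d) (fundamentalRep (Fin N)) ((N : ℝ) * β) W supp (starWinZd cc) ζ) =
          ∫ σ, f σ ∂(perturbedYM (d := d) (fundamentalRep (Fin N)) ((N : ℝ) * β) W supp (starWinZd cc) ζ') :=
    fun cc ζ ζ' hζ f hfm _ hfdep => perturbed_star_hloc _ (continuous_fundamentalRep (Fin N)) _
      (fun X => (hW.continuous X).measurable) hW.dependsOn hW.supportedBy hW.range hD cc ζ ζ' hζ f hfm hfdep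
  have hdoor := starWindowBoundZdR_of_memBallZdG hd hN hK hRm hmod hε₁ hc hlam hθ hθ1 hcd hρ hW
  have hA : ∀ a b : SUN N, dist (suEntries a) (suEntries b) ≤ 1 * suFrobDist a b := fun a b => by
    rw [one_mul]; exact dist_suEntries_le_suFrobDist a b
  have key := abs_covariance_kernel_le_of_starWindowBoundZdR hγ (D := max R 1 + 2) (by omega) hloc hρ0 hρ1 hdoor Λ₀ η φ hφ hφΛ
    hF₁.measurable hF₂.measurable hF₁.abs_le hF₂.abs_le hF₁.dependsOn hF₂.dependsOn
    (hF₁.isLipBound zero_le_one hA) (hF₂.isLipBound zero_le_one hA) hΛ₁ hm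
  have hsum₁ : ∑ y ∈ Λ₁, (if y ∈ Λ₁ then 1 * (K₁ : ℝ) else 0) = Λ₁.card * K₁ := by
    rw [Finset.sum_ite_of_true (fun y hy => hy), Finset.sum_const, nsmul_eq_mul, one_mul]
  have hsum₂ : ∑ y ∈ Λ₂, (if y ∈ Λ₂ then 1 * (K₂ : ℝ) else 0) = Λ₂.card * K₂ := by
    rw [Finset.sum_ite_of_true (fun y hy => hy), Finset.sum_const, nsmul_eq_mul, one_mul]
  rw [hsum₁, hsum₂] at key
  refine key.trans (le_of_eq ?_)
  ring

/-- ★★ **BOUNDARY DECAY UNIFORMLY ON THE GAUGE-INVARIANT TIER-1 `ℤ^d` BALL through the ROBUST STAR DOOR.** Same hypotheses; for EVERY member, every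
DLR state `μ` of the member, every finite `Λ₀`, EVERY boundary field `η`, every depth function `φ` and every Lipschitz cylinder `F` (constant `K`,
links `Δ ⊆ Λ₀` with `φ ≥ m` on `Δ`): `|∫F dγ^W_{Λ₀}(·|η) − ∫F dμ| ≤ (2√N) · K · #Δ · ρ^{⌊m/(D+2)⌋}`, `D = max R 1 + 2` (geometric rate).
[folklore] -/
theorem boundary_decay_of_robustStar (hd : 2 ≤ d) (hN : 1 ≤ N) {β ε₀ ε₁ Rm K c lam θ ρ : ℝ} {R Kn : ℕ}
    (hK : 0 ≤ K) (hRm : |(N : ℝ) * β| / N * (2 * ((d : ℝ) - 1)) ≤ Rm) (hmod : OneLinkKRModulus N Rm K)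
    (hε₁ : 0 ≤ ε₁) (hc : K * Real.exp ε₀ * (1 + 2 * Real.sqrt N * ε₁) * (|(N : ℝ) * β| / N) ≤ c)
    (hlam : Real.sqrt N * ε₁ ≤ lam) (hθ : θ = (2 * (d : ℝ) - 2) * c + lam) (hθ1 : θ < 1)
    (hcd : doorPoly d c < 1) (hρ : ρ = gaugeR d c + (lam + θ ^ Kn * (4 * d * lam)) / (1 - θ)) (hρ1 : ρ < 1)
    {W : Potential (ZdEdge d) (SUN N)} {supp : Finset (ZdEdge d) → Finset (Finset (ZdEdge d))}
    (hW : MemBallZdG ε₀ ε₁ R W supp)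
    {μ : Measure (LGConfig d (SUN N))} (hμ : μ ∈ perturbedGibbsMeasures (d := d) (fundamentalRep (Fin N)) ((N : ℝ) * β) W supp)
    (Λ₀ : Finset (ZdEdge d)) (η : LGConfig d (SUN N)) (φ : ZdEdge d → ℝ)
    (hφ : ∀ x y : ZdEdge d, φ x ≤ φ y + ‖x.1 - y.1‖) (hφΛ : ∀ x, 0 < φ x → x ∈ Λ₀)
    {F : LGConfig d (SUN N) → ℝ} {Δ : Finset (ZdEdge d)} {K₀ : ℝ≥0}
    (hF : IsLipschitzCylinder (fundamentalRep (Fin N)) F Δ K₀) (hΔ : Δ ⊆ Λ₀) {m : ℝ} (hm : ∀ x ∈ Δ, m ≤ φ x) :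
    |(∫ U, F U ∂(perturbedYM (d := d) (fundamentalRep (Fin N)) ((N : ℝ) * β) W supp Λ₀ η)) - ∫ U, F U ∂μ| ≤
      2 * Real.sqrt N * K₀ * Δ.card * ρ ^ ⌊m / (max R 1 + 2 + 2 : ℕ)⌋₊ := by
  classical
  haveI : SecondCountableTopology (Matrix (Fin N) (Fin N) ℂ) :=
    inferInstanceAs (SecondCountableTopology (Fin N → Fin N → ℂ))
  haveI : SecondCountableTopology (SUN N) := Topology.IsEmbedding.subtypeVal.secondCountableTopology
  have hc0 : 0 ≤ c := le_trans (by positivity) hc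
  have hlam0 : 0 ≤ lam := le_trans (by positivity) hlam
  have hgR : 0 ≤ gaugeR d c ∧ gaugeR d c < 1 := gaugeR_lt_one_of_door hd hc0 hcd
  have hd2 : (2 : ℝ) ≤ d := by exact_mod_cast hd
  have hθ0 : 0 ≤ θ := by rw [hθ]; nlinarith
  have h1θ : 0 < 1 - θ := by linarith
  have hρ0 : 0 ≤ ρ := by
    rw [hρ]
    refine add_nonneg hgR.1 (div_nonneg (add_nonneg hlam0 ?_) h1θ.le)
    have : 0 ≤ θ ^ Kn := pow_nonneg hθ0 Kn
    positivity
  have hWb : ∀ X, ∃ C, ∀ U, |W X U| ≤ C := fun X => exists_bound_of_continuous (hW.continuous X)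
  have hγ : IsSpecification (perturbedYM (d := d) (fundamentalRep (Fin N)) ((N : ℝ) * β) W supp) :=
    isSpecification_perturbedYM _ (continuous_fundamentalRep (Fin N)) _
      (fun X => ⟨hW.dependsOn X, (hW.continuous X).measurable⟩) hWb hW.supportedBy
  have hD : R + 2 ≤ max R 1 + 2 := by omega
  have hloc : ∀ (cc : ZdEdge d) (ζ ζ' : LGConfig d (SUN N)), (∀ v ∈ starNbhdZdR (max R 1 + 2) cc.1, ζ v = ζ' v) →
      ∀ (f : LGConfig d (SUN N) → ℝ), Measurable f → (∃ B, ∀ σ, |f σ| ≤ B) →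
        DependsOn f (starWinZd cc : Set (ZdEdge d)) →
        ∫ σ, f σ ∂(perturbedYM (d := d) (fundamentalRep (Fin N)) ((N : ℝ) * β) W supp (starWinZd cc) ζ) =
          ∫ σ, f σ ∂(perturbedYM (d := d) (fundamentalRep (Fin N)) ((N : ℝ) * β) W supp (starWinZd cc) ζ') :=
    fun cc ζ ζ' hζ f hfm _ hfdep => perturbed_star_hloc _ (continuous_fundamentalRep (Fin N)) _
      (fun X => (hW.continuous X).measurable) hW.dependsOn hW.supportedBy hW.range hD cc ζ ζ' hζ f hfm hfdep
  obtain ⟨Karr, hK0, hKsupp, hcontract, hsum⟩ :=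
    starWindowBoundZdR_of_memBallZdG hd hN hK hRm hmod hε₁ hc hlam hθ hθ1 hcd hρ hW
  have hA : ∀ a b : SUN N, dist (suEntries a) (suEntries b) ≤ 1 * suFrobDist a b := fun a b => by
    rw [one_mul]; exact dist_suEntries_le_suFrobDist a b
  have hμ' : IsGibbsMeasure (perturbedYM (d := d) (fundamentalRep (Fin N)) ((N : ℝ) * β) W supp) μ := hμ
  have hD1 : 1 ≤ max R 1 + 2 := by omega
  have key := abs_kernel_sub_integral_le_of_starArray_geometric hγ (D := max R 1 + 2) hD1
    (nbhd := fun cc => starNbhdZdR (max R 1 + 2) cc.1)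
    (fun cc => vertexStarZd_subset_starNbhdZdR hD1 cc.1) (fun cc y hy i => (mem_starNbhdZdR.1 hy) i) hloc hK0
    (fun cc y x h' => hKsupp _ _ _ h') hcontract hρ0 hρ1 (fun cc x hx => hsum cc.1 x hx) hμ' Λ₀ η φ hφ hφΛ
    hF.measurable hF.abs_le hF.dependsOn (hF.isLipBound zero_le_one hA) hΔ hm
  have hsum₁ : ∑ y ∈ Δ, (if y ∈ Δ then 1 * (K₀ : ℝ) else 0) = Δ.card * K₀ := by
    rw [Finset.sum_ite_of_true (fun y hy => hy), Finset.sum_const, nsmul_eq_mul, one_mul]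
  rw [hsum₁] at key
  refine key.trans (le_of_eq ?_)
  ring

/-! ### `SU(2)`, `d = 4`: the schema on the quarter modulus and the row up to `β_W = 1/3` -/

/-- **SCHEMA, `SU(2)`, `d = 4` (hypotheses of ds-2's `su2_massGapOnBallZdG_star`)**: with decimal majorants `e^{ε₀} ≤ E`, `√2 ≤ S`,
`c ≥ E(1 + 2Sε₁)β_W/4`, `λ ≥ Sε₁`, `doorPoly 4 c < 1`, `6c + λ < 1`, `ρ = gaugeR 4 c + (λ + (6c+λ)^K·16λ)/(1 − (6c+λ)) < 1`: for EVERY member of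
`MemBallZdG ε₀ ε₁ R`, every finite `Λ₀`, EVERY `η`, every depth function and Lipschitz cylinders `F₁` (`Λ₁ ⊆ Λ₀`, `φ ≥ m`), `F₂`:
`|cov_{γ^W_{Λ₀}(·|η)}(F₁, F₂)| ≤ 16 #Λ₁ #Λ₂ K₁K₂ · ρ^{min(⌊dist/(D+2)⌋, ⌊m/(D+2)⌋)}`, `D = max R 1 + 2`. [folklore] -/
theorem su2_kernel_covariance_decay_star_ball (Kn : ℕ) {βW ε₀ ε₁ c lam E S : ℝ} (hβ0 : 0 ≤ βW) (hβ : βW ≤ 2 / 3)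
    (hε₁ : 0 ≤ ε₁) (hE : Real.exp ε₀ ≤ E) (hS : Real.sqrt 2 ≤ S) (hc : E * (1 + 2 * S * ε₁) * (βW / 4) ≤ c)
    (hlam : S * ε₁ ≤ lam) (hθ1 : 6 * c + lam < 1) (hcd : doorPoly 4 c < 1)
    (hρ1 : gaugeR 4 c + (lam + (6 * c + lam) ^ Kn * (16 * lam)) / (1 - (6 * c + lam)) < 1) {R : ℕ}
    {W : Potential (ZdEdge 4) (SUN 2)} {supp : Finset (ZdEdge 4) → Finset (Finset (ZdEdge 4))}
    (hW : MemBallZdG ε₀ ε₁ R W supp)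
    (Λ₀ : Finset (ZdEdge 4)) (η : LGConfig 4 (SUN 2)) (φ : ZdEdge 4 → ℝ)
    (hφ : ∀ x y : ZdEdge 4, φ x ≤ φ y + ‖x.1 - y.1‖) (hφΛ : ∀ x, 0 < φ x → x ∈ Λ₀)
    {F₁ F₂ : LGConfig 4 (SUN 2) → ℝ} {Λ₁ Λ₂ : Finset (ZdEdge 4)} {K₁ K₂ : ℝ≥0}
    (hF₁ : IsLipschitzCylinder (fundamentalRep (Fin 2)) F₁ Λ₁ K₁)
    (hF₂ : IsLipschitzCylinder (fundamentalRep (Fin 2)) F₂ Λ₂ K₂) (hΛ₁ : Λ₁ ⊆ Λ₀) {m : ℝ} (hm : ∀ x ∈ Λ₁, m ≤ φ x) :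
    |cov[F₁, F₂; perturbedYM (d := 4) (fundamentalRep (Fin 2)) ((2 : ℕ) * (βW / 4)) W supp Λ₀ η]| ≤
      16 * Λ₁.card * Λ₂.card * ((K₁ : ℝ) * K₂) *
        (gaugeR 4 c + (lam + (6 * c + lam) ^ Kn * (16 * lam)) / (1 - (6 * c + lam))) ^
          (min (⌊setDistEdges Λ₁ Λ₂ / (max R 1 + 2 + 2 : ℕ)⌋₊) (⌊m / (max R 1 + 2 + 2 : ℕ)⌋₊)) := by
  have hS0 : 0 ≤ S := (Real.sqrt_nonneg _).trans hS
  have hE0 : 0 ≤ E := (Real.exp_pos _).le.trans hE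
  set θ : ℝ := 6 * c + lam with hθ
  set ρ : ℝ := gaugeR 4 c + (lam + θ ^ Kn * (16 * lam)) / (1 - θ) with hρ
  have habs : |((2 : ℕ) : ℝ) * (βW / 4)| / ((2 : ℕ) : ℝ) = βW / 4 := by
    rw [abs_of_nonneg (by positivity)]
    push_cast
    ring
  have hR : |((2 : ℕ) : ℝ) * (βW / 4)| / ((2 : ℕ) : ℝ) * (2 * (((4 : ℕ) : ℝ) - 1)) ≤ 3 * βW / 2 := by
    rw [habs]; push_cast; linarith
  have hc' : (1 : ℝ) * Real.exp ε₀ * (1 + 2 * Real.sqrt ((2 : ℕ) : ℝ) * ε₁) *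
      (|((2 : ℕ) : ℝ) * (βW / 4)| / ((2 : ℕ) : ℝ)) ≤ c := by
    refine le_trans ?_ hc
    have h1 : Real.sqrt ((2 : ℕ) : ℝ) = Real.sqrt 2 := by norm_num
    rw [h1, one_mul, habs]
    have hb : 0 ≤ βW / 4 := by positivity
    calc Real.exp ε₀ * (1 + 2 * Real.sqrt 2 * ε₁) * (βW / 4) ≤ E * (1 + 2 * Real.sqrt 2 * ε₁) * (βW / 4) := by
          gcongr
      _ ≤ E * (1 + 2 * S * ε₁) * (βW / 4) := by gcongr
  have hlam' : Real.sqrt ((2 : ℕ) : ℝ) * ε₁ ≤ lam := by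
    have h1 : Real.sqrt ((2 : ℕ) : ℝ) = Real.sqrt 2 := by norm_num
    rw [h1]; exact le_trans (mul_le_mul_of_nonneg_right hS hε₁) hlam
  have hθ' : θ = (2 * ((4 : ℕ) : ℝ) - 2) * c + lam := by rw [hθ]; push_cast; ring
  have hρ' : ρ = gaugeR 4 c + (lam + θ ^ Kn * (4 * ((4 : ℕ) : ℝ) * lam)) / (1 - θ) := by rw [hρ]; push_cast; ring
  have key := kernel_covariance_decay_of_robustStar (d := 4) (N := 2) (by norm_num) (by norm_num) zero_le_one hR
    (su2_quarterModulus hβ) hε₁ hc' hlam' hθ' hθ1 hcd hρ' hρ1 hW Λ₀ η φ hφ hφΛ hF₁ hF₂ hΛ₁ hm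
  have hsq : (2 * Real.sqrt (2 : ℕ)) ^ 2 = 8 := by
    rw [mul_pow, Real.sq_sqrt (by positivity)]; norm_num
  rw [hsq] at key
  refine key.trans (le_of_eq ?_)
  ring

/-- ★★ **ROW UP TO `β_W = 1/3`, `SU(2)`, `d = 4`, HYPOTHESIS-FREE**: for EVERY Wilson coupling `0 ≤ β_W ≤ 1/3`, every member of the gauge-invariant
tier-1 ball `MemBallZdG (3/125) (3/250) R` (any range `R`), every finite link volume `Λ₀`, EVERY boundary field `η`, every depth function `φ` and
Lipschitz cylinders `F₁` (`Λ₁ ⊆ Λ₀`, `φ ≥ m` on `Λ₁`), `F₂`: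
`|cov_{γ^W_{Λ₀}(·|η)}(F₁, F₂)| ≤ 16 #Λ₁ #Λ₂ K₁K₂ · ρ⋆^{min(⌊dist(Λ₁,Λ₂)/(max R 1 + 4)⌋, ⌊m/(max R 1 + 4)⌋)}` with the certified
received sum `ρ⋆ = gaugeR 4 c + (λ + (6c+λ)^20·16λ)/(1 − (6c+λ))`, `c = 17651/200000`, `λ = 16971/1000000` (the certificate of
`su2_massGapOnBallZdG_star_upTo_oneThird`). [folklore] -/
theorem su2_kernel_covariance_decay_star_ball_upTo_oneThird {βW : ℝ} (h0 : 0 ≤ βW) (h : βW ≤ 1 / 3) {R : ℕ}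
    {W : Potential (ZdEdge 4) (SUN 2)} {supp : Finset (ZdEdge 4) → Finset (Finset (ZdEdge 4))}
    (hW : MemBallZdG (3 / 125) (3 / 250) R W supp)
    (Λ₀ : Finset (ZdEdge 4)) (η : LGConfig 4 (SUN 2)) (φ : ZdEdge 4 → ℝ)
    (hφ : ∀ x y : ZdEdge 4, φ x ≤ φ y + ‖x.1 - y.1‖) (hφΛ : ∀ x, 0 < φ x → x ∈ Λ₀)
    {F₁ F₂ : LGConfig 4 (SUN 2) → ℝ} {Λ₁ Λ₂ : Finset (ZdEdge 4)} {K₁ K₂ : ℝ≥0}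
    (hF₁ : IsLipschitzCylinder (fundamentalRep (Fin 2)) F₁ Λ₁ K₁)
    (hF₂ : IsLipschitzCylinder (fundamentalRep (Fin 2)) F₂ Λ₂ K₂) (hΛ₁ : Λ₁ ⊆ Λ₀) {m : ℝ} (hm : ∀ x ∈ Λ₁, m ≤ φ x) :
    |cov[F₁, F₂; perturbedYM (d := 4) (fundamentalRep (Fin 2)) ((2 : ℕ) * (βW / 4)) W supp Λ₀ η]| ≤
      16 * Λ₁.card * Λ₂.card * ((K₁ : ℝ) * K₂) *
        (gaugeR 4 (17651 / 200000 : ℝ) + ((16971 / 1000000 : ℝ) +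
            (6 * (17651 / 200000 : ℝ) + 16971 / 1000000) ^ 20 * (16 * (16971 / 1000000 : ℝ))) /
            (1 - (6 * (17651 / 200000 : ℝ) + 16971 / 1000000))) ^
          (min (⌊setDistEdges Λ₁ Λ₂ / (max R 1 + 2 + 2 : ℕ)⌋₊) (⌊m / (max R 1 + 2 + 2 : ℕ)⌋₊)) := by
  refine su2_kernel_covariance_decay_star_ball 20 (ε₀ := 3 / 125) (ε₁ := 3 / 250) (c := 17651 / 200000)
    (lam := 16971 / 1000000) (E := 1024291 / 1000000) (S := 1.41422) h0 (h.trans (by norm_num)) (by norm_num)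
    exp_le_3_125_star sqrt_two_le ?_ (by norm_num) (by norm_num) (by unfold doorPoly; norm_num)
    (by unfold gaugeR Delta; norm_num) hW Λ₀ η φ hφ hφΛ hF₁ hF₂ hΛ₁ hm
  calc (1024291 / 1000000 : ℝ) * (1 + 2 * 1.41422 * (3 / 250)) * (βW / 4)
      ≤ 1024291 / 1000000 * (1 + 2 * 1.41422 * (3 / 250)) * ((1 / 3) / 4) := by gcongr
    _ ≤ 17651 / 200000 := by norm_num

/-- ★★ **BOUNDARY-DECAY ROW UP TO `β_W = 1/3`, `SU(2)`, `d = 4`, HYPOTHESIS-FREE**: for every `0 ≤ β_W ≤ 1/3`, every member of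
`MemBallZdG (3/125) (3/250) R`, every DLR state `μ` of the member, every finite `Λ₀`, EVERY boundary field `η`, every depth function `φ` and every
Lipschitz cylinder `F` (constant `K`, links `Δ ⊆ Λ₀`, `φ ≥ m` on `Δ`): `|∫F dγ^W_{Λ₀}(·|η) − ∫F dμ| ≤ 2√2 · K · #Δ · ρ⋆^{⌊m/(max R 1 + 4)⌋}`
with the certified `ρ⋆ < 1` of the previous row (geometric rate). [folklore] -/
theorem su2_boundary_decay_star_ball_upTo_oneThird {βW : ℝ} (h0 : 0 ≤ βW) (h : βW ≤ 1 / 3) {R : ℕ}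
    {W : Potential (ZdEdge 4) (SUN 2)} {supp : Finset (ZdEdge 4) → Finset (Finset (ZdEdge 4))}
    (hW : MemBallZdG (3 / 125) (3 / 250) R W supp)
    {μ : Measure (LGConfig 4 (SUN 2))}
    (hμ : μ ∈ perturbedGibbsMeasures (d := 4) (fundamentalRep (Fin 2)) ((2 : ℕ) * (βW / 4)) W supp)
    (Λ₀ : Finset (ZdEdge 4)) (η : LGConfig 4 (SUN 2)) (φ : ZdEdge 4 → ℝ)
    (hφ : ∀ x y : ZdEdge 4, φ x ≤ φ y + ‖x.1 - y.1‖) (hφΛ : ∀ x, 0 < φ x → x ∈ Λ₀)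
    {F : LGConfig 4 (SUN 2) → ℝ} {Δ : Finset (ZdEdge 4)} {K₀ : ℝ≥0}
    (hF : IsLipschitzCylinder (fundamentalRep (Fin 2)) F Δ K₀) (hΔ : Δ ⊆ Λ₀) {m : ℝ} (hm : ∀ x ∈ Δ, m ≤ φ x) :
    |(∫ U, F U ∂(perturbedYM (d := 4) (fundamentalRep (Fin 2)) ((2 : ℕ) * (βW / 4)) W supp Λ₀ η)) - ∫ U, F U ∂μ| ≤
      2 * Real.sqrt 2 * K₀ * Δ.card *
        (gaugeR 4 (17651 / 200000 : ℝ) + ((16971 / 1000000 : ℝ) +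
            (6 * (17651 / 200000 : ℝ) + 16971 / 1000000) ^ 20 * (16 * (16971 / 1000000 : ℝ))) /
            (1 - (6 * (17651 / 200000 : ℝ) + 16971 / 1000000))) ^ ⌊m / (max R 1 + 2 + 2 : ℕ)⌋₊ := by
  have hβ : βW ≤ 2 / 3 := h.trans (by norm_num)
  set c : ℝ := 17651 / 200000 with hc
  set lam : ℝ := 16971 / 1000000 with hlam
  set θ : ℝ := 6 * c + lam with hθ
  set ρ : ℝ := gaugeR 4 c + (lam + θ ^ 20 * (16 * lam)) / (1 - θ) with hρ
  have habs : |((2 : ℕ) : ℝ) * (βW / 4)| / ((2 : ℕ) : ℝ) = βW / 4 := by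
    rw [abs_of_nonneg (by positivity)]
    push_cast
    ring
  have hR : |((2 : ℕ) : ℝ) * (βW / 4)| / ((2 : ℕ) : ℝ) * (2 * (((4 : ℕ) : ℝ) - 1)) ≤ 3 * βW / 2 := by
    rw [habs]; push_cast; linarith
  have hc' : (1 : ℝ) * Real.exp (3 / 125) * (1 + 2 * Real.sqrt ((2 : ℕ) : ℝ) * (3 / 250)) *
      (|((2 : ℕ) : ℝ) * (βW / 4)| / ((2 : ℕ) : ℝ)) ≤ c := by
    have h1 : Real.sqrt ((2 : ℕ) : ℝ) = Real.sqrt 2 := by norm_num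
    rw [h1, one_mul, habs]
    have hb : 0 ≤ βW / 4 := by positivity
    calc Real.exp (3 / 125) * (1 + 2 * Real.sqrt 2 * (3 / 250)) * (βW / 4)
        ≤ (1024291 / 1000000) * (1 + 2 * 1.41422 * (3 / 250)) * ((1 / 3) / 4) := by
          gcongr
          · exact exp_le_3_125_star
          · exact sqrt_two_le
      _ ≤ c := by rw [hc]; norm_num
  have hlam' : Real.sqrt ((2 : ℕ) : ℝ) * (3 / 250) ≤ lam := by
    have h1 : Real.sqrt ((2 : ℕ) : ℝ) = Real.sqrt 2 := by norm_num
    rw [h1, hlam]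
    calc Real.sqrt 2 * (3 / 250) ≤ 1.41422 * (3 / 250) := mul_le_mul_of_nonneg_right sqrt_two_le (by norm_num)
      _ ≤ 16971 / 1000000 := by norm_num
  have hθ' : θ = (2 * ((4 : ℕ) : ℝ) - 2) * c + lam := by rw [hθ]; push_cast; ring
  have hθ1 : θ < 1 := by rw [hθ, hc, hlam]; norm_num
  have hcd : doorPoly 4 c < 1 := by rw [hc]; unfold doorPoly; norm_num
  have hρ' : ρ = gaugeR 4 c + (lam + θ ^ 20 * (4 * ((4 : ℕ) : ℝ) * lam)) / (1 - θ) := by rw [hρ]; push_cast; ring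
  have hρ1 : ρ < 1 := by rw [hρ, hθ, hc, hlam]; unfold gaugeR Delta; norm_num
  have key := boundary_decay_of_robustStar (d := 4) (N := 2) (Kn := 20) (by norm_num) (by norm_num) zero_le_one hR
    (su2_quarterModulus hβ) (by norm_num) hc' hlam' hθ' hθ1 hcd hρ' hρ1 hW hμ Λ₀ η φ hφ hφΛ hF hΔ hm
  have hsq : Real.sqrt ((2 : ℕ) : ℝ) = Real.sqrt 2 := by norm_num
  rw [hsq] at key
  refine key.trans (le_of_eq ?_)
  ring

end Summit.Ventures.YMGap.RobustBall

end
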